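import Literature.MeasureTheory.Group.SubgroupRelIndexMeasure
import Literature.NumberTheory.Automorphic.GLnCongruenceSubgroups
import Literature.NumberTheory.Automorphic.IwahoriGL
import Literature.NumberTheory.Automorphic.UnitaryGroupOfFormAdelicTopology
import HarnessLib

/-!
# Integral points of a unitary group over a non-archimedean local field: reduction modulo `𝔭`, the first congruence subgroup,
# and the level-structure volume identity `vol U(J)(𝒪) = |red U(J)(𝒪)| · vol U(J)(𝒪)₁` (`= |U(σ̄, J̄)(𝓀)| · vol U(J)(𝒪)₁` when `red` is onto)

Topic `NumberTheory/Automorphic`; namespace `Literature.NumberTheory.Automorphic`.  THEOREMS ONLY (no definition, no instance, no notation, no named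
fact).  Cell `hodgecm-mathlib`, F0∕P3a road D-T «volumes ∕ Tamagawa numbers» (the constants `m(Z_H∖H)`, `τ(U) = 2` of [Rogawski1990, Thm. 14.5.1,
§14.5 p. 238]), brick **D-T1u** (LEAD F0P3a-plan (g7) T6-80∕T6-86; seat F0P3-p02 (g10)) — the UNITARY analogue of ★ D-T1b `LocalFieldGLnVolume` ∕ ★ D-T1c
`GLnIntegerPointsVolume` (`vol GLₙ(𝒪) = |GLₙ(𝓀)| · vol Mₙ(𝔭)`), docking BY NAME on «D-T1e» ★ `FieldTheory/FiniteFields/HermitianSphereCount` ∕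
`GroupTheory/SpecificGroups/FiniteUnitaryGroupCard` (`|Uₙ(𝔽_{q²}∕𝔽_q)|`, binders `(σ : k →+* k) (hσ : ∀ x, σ x = x ^ q)`).

SETTING (generic-then-instantiate; the tree's currency, NO new object).  `E` a non-archimedean local field (Mathlib `IsNonarchimedeanLocalField`; `𝒪 = 𝒪[E]`,
residue field `𝓀 = 𝓀[E]`, `ϖ := ValuativeRel.uniformizer E` the largest value `< 1`, Mathlib `le_uniformizer_iff`), `σ : E →+* E` any ring endomorphism (at a
non-split place of a quadratic `E/F`: the conjugation `σ_w = galAdicCompletionMap c hw` of ★ `UnitaryGroupNonsplitPlaceModel`), `J ∈ Mₙ(E)`,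
`U := unitaryGroupOfForm σ J ≤ GLₙ(E)` (★ `UnitaryGroupAutomorphicRep`).  Levels, as subgroups of `↥U` (Mathlib `Subgroup.subgroupOf`, the spelling
`Subgroup.relIndex` unfolds to; ★ n = 3 precedent `UnitaryGroup.isCompact_isOpen_comap_congruenceGL`):
`K := (glInt n E).subgroupOf U` = `U(J)(𝒪) = U ∩ GLₙ(𝒪)` (★ `glInt`, `ReductiveGroupData`) and the FIRST CONGRUENCE SUBGROUP
`K₁ := (congruenceGL n ϖ).subgroupOf U` = `U(J)(𝒪)₁ = U ∩ (1 + 𝔭Mₙ(𝒪))` (★ `congruenceGL`, `GLnCongruenceSubgroups`, at level `ϖ`).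

* §1 (`GLₙ`) the kernel of ★ `glIntReduction n E : glInt n E →* GLₙ(𝓀)` (`IwahoriGL`) IS `congruenceGL n ϖ`: `glIntReduction_eq_one_iff_valBound`,
  **`ker_glIntReduction_eq_congruenceGL_subgroupOf`**, `mem_congruenceGL_uniformizer_iff` (`g ∈ 1 + 𝔭Mₙ(𝒪) ↔ g ∈ GLₙ(𝒪) ∧ v((g − 1)_{ij}) < 1`, no condition on
  `g⁻¹`), `relIndex_congruenceGL_glInt_eq_natCard` (`[GLₙ(𝒪) : 1 + 𝔭Mₙ(𝒪)] = |GLₙ(𝓀)|`), **`measure_glInt_eq_natCard_GL_residueField_mul`** (`μ GLₙ(𝒪) = |GLₙ(𝓀)| · μ(1 + 𝔭Mₙ(𝒪))`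
  for every left-invariant Borel `μ` on `GLₙ(E)` — the multiplicative twin of ★ D-T1b `measure_setOf_integer_normAbs_det_eq_one`).
* §2 (`U`) (u1) `isOpen_∕isCompact_subgroupOf_unitaryGroupOfForm` (traces of open ∕ compact subgroups of `GLₙ(E)`; compactness for continuous `σ`, ★
  `isClosed_unitaryGroupOfForm`), `isCompact_isOpen_glInt_subgroupOf_unitaryGroupOfForm`, `isCompact_isOpen_congruenceGL_subgroupOf_unitaryGroupOfForm` (any `n`, `J`);
  (u2) **`exists_unitary_residueHom`**: for `J = J_𝒪` integral and `σ` preserving `𝒪` with reduction `σk` on `𝓀` (hypotheses `hσO`, `hσk`; the consumer's token —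
  inert place ⇒ `σk = (· ^ q)`, ramified ⇒ `σk = id`), reduction of entries is a homomorphism `red : ↥K →* ↥(unitaryGroupOfForm σk (J_𝒪 mod 𝔭))` with
  `(red g)_{ij} = g_{ij} mod 𝔭` (only this ENTRY FORMULA is exported); (u2′) **`ker_unitary_residueHom_eq`**: ANY homomorphism on `K` with the entry formula (values
  in any subgroup of `GLₙ(𝓀)`) has kernel `K₁.subgroupOf K` (which is OPEN: `red` is continuous for the discrete topology of its finite target; `𝓀[E]` carries no
  topology instance, so no `Continuous` head is stated); (u3) **`measure_glInt_subgroupOf_eq_natCard_range_mul`** `μ K = |red(K)| · μ K₁` for every left-invariant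
  Borel `μ` on `↥U`, **`measure_glInt_subgroupOf_eq_natCard_mul_of_surjective`** `μ K = |Q| · μ K₁` under `Function.Surjective red` onto `Q ≤ GLₙ(𝓀)`, and the
  reduction-free **`measure_glInt_subgroupOf_eq_relIndex_mul`**: `[K : K₁] ≠ 0` and `μ K = [K : K₁] · μ K₁`.

NOT PROVED HERE (named for the consumer): surjectivity of `red` onto `U(σ̄, J̄)(𝓀)` (Hensel ∕ smoothness of `U_J` over `𝒪` at an unramified place — the
hypothesis `hsurj`); the identification `σ̄ = (· ^ q_v)`, `|𝓀| = q_v²` at an INERT place (★ `valued_galAdicCompletionMap_sub_pow_lt_one`) and the transport to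
the carriers `localPi ∕ localInt` (★ `exists_mulEquiv_localPi_of_smul_eq`) — sequel «D-T1u-inert»; `vol U(J)(𝒪)₁` against the Lie lattice (gauge forms, D-T3).
HC_CM is proved only modulo the printed citations until rung 0 closes; this file is unconditional and generic.

Tree ∕ Mathlib search (`rg`): ★ `glInt`, `mem_glInt_iff`, `isOpen_glInt`, `isCompact_glInt` (`ReductiveGroupData`); ★ `congruenceGL`, `mem_congruenceGL_iff`,
`congruenceGL_le_glInt`, `isOpen_congruenceGL`, `isCompact_congruenceGL`, `ValBound` (`GLnCongruenceSubgroups`); ★ `glIntReduction`, `coe_glIntReduction_apply`,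
`apply_mem_integer_of_mem_glInt`, `residue_eq_zero_iff_valuation_lt_one` (`IwahoriGL`); ★ `glIntReduction_surjective` (`CuspidalTypeOfResidual` — re-proved privately
here to keep the import closure free of the Hilbert-space spectrum files); ★ `unitaryGroupOfForm`, `mem_unitaryGroupOfForm_iff`, `map_mem_unitaryGroupOfForm`,
`isClosed_unitaryGroupOfForm`; ★ `Literature.MeasureTheory.Group.measure_subgroup_eq_relIndex_mul` (sibling brick); Mathlib `ValuativeRel.uniformizer`,
`le_uniformizer_iff`, `uniformizer_ne_zero`, `IsLocalRing.residue_surjective`, `isUnit_of_map_unit`, `Matrix.GeneralLinearGroup.mk''`, `Matrix.map_injective`.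
Dedup: `rg "ker_glIntReduction|congruenceGL n \(uniformizer|unitary_residueHom|measure_glInt" Literature` — none.

## References
* [PlatonovRapinchuk1994] V. Platonov, A. Rapinchuk, *Algebraic Groups and Number Theory* (1994), §3.3 (congruence subgroups `G_𝒪(𝔭^a)`, reduction mod `𝔭`, volumes
  of `G_{𝒪_v}`), §5.1.
* [Weil1982] A. Weil, *Adeles and Algebraic Groups*, Progress in Math. 23 (1982), Ch. II §2.2, Thm. 2.2.5 (`vol G(𝒪)` by counting points of the reduction).
* [Rogawski1990] J. D. Rogawski, *Automorphic Representations of Unitary Groups in Three Variables*, Ann. of Math. Stud. 123 (1990), §14.5 p. 238, Thm. 14.5.1.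
* [Tits1979] J. Tits, *Reductive groups over local fields*, PSPM 33.1 (1979), §3.8 (hyperspecial `U(J)(𝒪_v)` at unramified `v`).
-/

set_option autoImplicit false

noncomputable section

open MeasureTheory ValuativeRel Matrix Literature.MeasureTheory.Group
open scoped MatrixGroups

namespace Literature.NumberTheory.Automorphic

/-! ## §1 `GLₙ`: the kernel of reduction modulo `𝔭` (★ `glIntReduction`) is `1 + 𝔭Mₙ(𝒪) = congruenceGL n ϖ`; volume identity -/

section GLn

variable {E : Type*} [Field E] [ValuativeRel E] {n : ℕ}

/-- Elements of `GLₙ(𝒪)` and their inverses have entries of valuation `≤ 1`. [cite: PlatonovRapinchuk1994, §3.3] -/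
theorem valBound_one_and_inv_of_mem_glInt {g : GL (Fin n) E} (hg : g ∈ glInt n E) :
    ValBound 1 (g : Matrix (Fin n) (Fin n) E) ∧ ValBound 1 ((g⁻¹ : GL (Fin n) E) : Matrix (Fin n) (Fin n) E) :=
  ⟨fun i j => (Valuation.mem_integer_iff _ _).1 (((mem_glInt_iff g).1 hg).1 i j),
    fun i j => (Valuation.mem_integer_iff _ _).1 (((mem_glInt_iff g).1 hg).2 i j)⟩

/-- **Reduction `GLₙ(𝒪) → GLₙ(𝓀)` is surjective** — private copy of ★ `glIntReduction_surjective` (`CuspidalTypeOfResidual`, whose import closure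
carries the Hilbert-space spectrum files) to keep this file's closure light: lift the entries; the lift has unit determinant since its residue
`det ≠ 0` and `𝒪` is local. [cite: PlatonovRapinchuk1994, §3.3] -/
private theorem glIntReduction_surjective' : Function.Surjective (glIntReduction n E) := by
  intro x
  choose S hS using fun i j => IsLocalRing.residue_surjective ((x : Matrix (Fin n) (Fin n) 𝓀[E]) i j)
  let M : Matrix (Fin n) (Fin n) 𝒪[E] := Matrix.of fun i j => S i j
  have hM : M.map (IsLocalRing.residue 𝒪[E]) = (x : Matrix (Fin n) (Fin n) 𝓀[E]) := by
    ext i j; exact hS i j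
  have hdet : IsUnit M.det := by
    apply isUnit_of_map_unit (IsLocalRing.residue 𝒪[E])
    rw [RingHom.map_det, RingHom.mapMatrix_apply, hM, ← Matrix.GeneralLinearGroup.val_det_apply]
    exact Units.isUnit _
  refine ⟨⟨Matrix.GeneralLinearGroup.map (𝒪[E]).subtype (Matrix.GeneralLinearGroup.mk'' M hdet), _, rfl⟩, ?_⟩
  apply Units.ext
  ext i j
  rw [coe_glIntReduction_apply, ← hS i j]
  rfl

variable [TopologicalSpace E] [IsNonarchimedeanLocalField E]

/-- Two integers have the same residue iff their difference has valuation `≤ ϖ` (`ϖ = ValuativeRel.uniformizer E`, the largest value `< 1`;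
★ `residue_eq_zero_iff_valuation_lt_one`, Mathlib `le_uniformizer_iff`). [cite: PlatonovRapinchuk1994, §3.3] -/
theorem residue_eq_residue_iff_valuation_sub_le_uniformizer (x y : 𝒪[E]) :
    IsLocalRing.residue 𝒪[E] x = IsLocalRing.residue 𝒪[E] y ↔ valuation E ((x : E) - y) ≤ uniformizer E := by
  rw [← sub_eq_zero, ← map_sub, residue_eq_zero_iff_valuation_lt_one, le_uniformizer_iff]
  rfl

/-- For `g ∈ GLₙ(𝒪)`: `ḡ = 1 ↔ g ≡ 1 mod 𝔭` entrywise, i.e. `ValBound ϖ (g − 1)` (★ `glIntReduction`, ★ `ValBound`). [cite: PlatonovRapinchuk1994, §3.3] -/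
theorem glIntReduction_eq_one_iff_valBound (g : ↥(glInt n E)) :
    glIntReduction n E g = 1 ↔ ValBound (uniformizer E) (((g : GL (Fin n) E) : Matrix (Fin n) (Fin n) E) - 1) := by
  constructor
  · intro h i j
    have hij := congrArg (fun w : GL (Fin n) 𝓀[E] => (w : Matrix (Fin n) (Fin n) 𝓀[E]) i j) h
    simp only [coe_glIntReduction_apply, Units.val_one] at hij
    rw [Matrix.sub_apply]
    by_cases hd : i = j
    · subst hd
      rw [Matrix.one_apply_eq] at hij ⊢
      rw [← map_one (IsLocalRing.residue 𝒪[E])] at hij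
      simpa using (residue_eq_residue_iff_valuation_sub_le_uniformizer _ _).1 hij
    · rw [Matrix.one_apply_ne hd] at hij ⊢
      rw [← map_zero (IsLocalRing.residue 𝒪[E])] at hij
      simpa using (residue_eq_residue_iff_valuation_sub_le_uniformizer _ _).1 hij
  · intro h
    apply Units.ext
    ext i j
    rw [coe_glIntReduction_apply, Units.val_one]
    have hij := h i j
    rw [Matrix.sub_apply] at hij
    by_cases hd : i = j
    · subst hd
      rw [Matrix.one_apply_eq] at hij ⊢
      rw [← map_one (IsLocalRing.residue 𝒪[E])]
      exact (residue_eq_residue_iff_valuation_sub_le_uniformizer _ _).2 (by simpa using hij)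
    · rw [Matrix.one_apply_ne hd] at hij ⊢
      rw [← map_zero (IsLocalRing.residue 𝒪[E])]
      exact (residue_eq_residue_iff_valuation_sub_le_uniformizer _ _).2 (by simpa using hij)

/-- **The kernel of reduction modulo `𝔭` is the first congruence subgroup** `1 + 𝔭Mₙ(𝒪) = congruenceGL n ϖ` (`ϖ = ValuativeRel.uniformizer E`):
`ker (glIntReduction n E) = congruenceGL n ϖ ∩ GLₙ(𝒪)` (the condition on `g⁻¹` in ★ `congruenceGL` is `ḡ⁻¹ = 1`). [cite: PlatonovRapinchuk1994, §3.3] -/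
theorem ker_glIntReduction_eq_congruenceGL_subgroupOf :
    (glIntReduction n E).ker = (congruenceGL n (uniformizer E)).subgroupOf (glInt n E) := by
  ext g
  rw [MonoidHom.mem_ker, Subgroup.mem_subgroupOf, mem_congruenceGL_iff]
  constructor
  · intro h
    refine ⟨valBound_one_and_inv_of_mem_glInt g.2, (glIntReduction_eq_one_iff_valBound g).1 h, ?_⟩
    have h' : glIntReduction n E g⁻¹ = 1 := by rw [map_inv, h, inv_one]
    exact (glIntReduction_eq_one_iff_valBound g⁻¹).1 h'
  · rintro ⟨-, h, -⟩
    exact (glIntReduction_eq_one_iff_valBound g).2 h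

/-- **Membership in the first congruence subgroup read on `g` alone**: `g ∈ congruenceGL n ϖ ↔ g ∈ GLₙ(𝒪) ∧ g ≡ 1 mod 𝔭` (entries of `g − 1`
of valuation `< 1`); the conditions on `g⁻¹` follow by reducing `g · g⁻¹ = 1`. [cite: PlatonovRapinchuk1994, §3.3] -/
theorem mem_congruenceGL_uniformizer_iff (g : GL (Fin n) E) :
    g ∈ congruenceGL n (uniformizer E) ↔
      g ∈ glInt n E ∧ ∀ i j, valuation E ((((g : Matrix (Fin n) (Fin n) E)) - 1) i j) < 1 := by
  constructor
  · intro hg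
    exact ⟨congruenceGL_le_glInt _ hg, fun i j => le_uniformizer_iff.1 (hg.2.1 i j)⟩
  · rintro ⟨hg, h⟩
    have hmem : (⟨g, hg⟩ : ↥(glInt n E)) ∈ (glIntReduction n E).ker :=
      (glIntReduction_eq_one_iff_valBound ⟨g, hg⟩).2 fun i j => le_uniformizer_iff.2 (h i j)
    rw [ker_glIntReduction_eq_congruenceGL_subgroupOf, Subgroup.mem_subgroupOf] at hmem
    exact hmem

/-- **`[GLₙ(𝒪) : 1 + 𝔭Mₙ(𝒪)] = |GLₙ(𝓀)|`** (reduction is onto with kernel the first congruence subgroup). [cite: PlatonovRapinchuk1994, §3.3] -/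
theorem relIndex_congruenceGL_glInt_eq_natCard :
    (congruenceGL n (uniformizer E)).relIndex (glInt n E) = Nat.card (GL (Fin n) 𝓀[E]) :=
  relIndex_eq_natCard_of_ker_eq_of_surjective _ ker_glIntReduction_eq_congruenceGL_subgroupOf glIntReduction_surjective'

/-- **`vol GLₙ(𝒪) = |GLₙ(𝓀)| · vol (1 + 𝔭Mₙ(𝒪))`** for every left-invariant Borel measure `μ` on `GLₙ(E)` (the multiplicative companion of ★ D-T1b
`measure_setOf_integer_normAbs_det_eq_one` on `Mₙ(E)`; `|GLₙ(𝓀)|` = ★ `card_GL_residueField`). [cite: PlatonovRapinchuk1994, §3.3] -/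
theorem measure_glInt_eq_natCard_GL_residueField_mul [MeasurableSpace (GL (Fin n) E)] [BorelSpace (GL (Fin n) E)]
    (μ : Measure (GL (Fin n) E)) [μ.IsMulLeftInvariant] :
    μ (glInt n E) = Nat.card (GL (Fin n) 𝓀[E]) * μ (congruenceGL n (uniformizer E)) := by
  haveI : Finite 𝓀[E] := inferInstance
  exact measure_subgroup_eq_natCard_mul_of_surjective μ (congruenceGL_le_glInt _) (isOpen_glInt n E).measurableSet
    (isOpen_congruenceGL uniformizer_ne_zero).measurableSet _ ker_glIntReduction_eq_congruenceGL_subgroupOf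
    glIntReduction_surjective'

end GLn

/-! ## §2 The unitary group `U(σ, J)(E)`: integral points, first congruence subgroup, reduction to `U(σ̄, J̄)(𝓀)`, volume identity -/

section Unitary

variable {E : Type*} [Field E] [ValuativeRel E] [TopologicalSpace E] [IsNonarchimedeanLocalField E] {n : ℕ}
  (σ : E →+* E) (J : Matrix (Fin n) (Fin n) E)

omit [ValuativeRel E] [IsNonarchimedeanLocalField E] in
/-- The trace `H ∩ U` on `U = U(σ, J)(E)` of an OPEN subgroup `H ≤ GLₙ(E)` is open in `U`. [cite: PlatonovRapinchuk1994, §3.3] -/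
theorem isOpen_subgroupOf_unitaryGroupOfForm {H : Subgroup (GL (Fin n) E)} (hH : IsOpen (H : Set (GL (Fin n) E))) :
    IsOpen ((H.subgroupOf (unitaryGroupOfForm σ J) : Subgroup ↥(unitaryGroupOfForm σ J)) : Set ↥(unitaryGroupOfForm σ J)) :=
  hH.preimage continuous_subtype_val

/-- The trace `H ∩ U` on `U = U(σ, J)(E)` of a COMPACT subgroup `H ≤ GLₙ(E)` is compact in `U`, for `σ` continuous (`U` is then closed in
`GLₙ(E)`, ★ `isClosed_unitaryGroupOfForm`). [cite: PlatonovRapinchuk1994, §3.3] -/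
theorem isCompact_subgroupOf_unitaryGroupOfForm (hσ : Continuous σ) {H : Subgroup (GL (Fin n) E)}
    (hH : IsCompact (H : Set (GL (Fin n) E))) :
    IsCompact ((H.subgroupOf (unitaryGroupOfForm σ J) : Subgroup ↥(unitaryGroupOfForm σ J)) : Set ↥(unitaryGroupOfForm σ J)) := by
  haveI : T2Space E := (Literature.NumberTheory.GaloisRepresentations.IsNonarchimedeanLocalField.isLocalField E).toT2Space
  exact (isClosed_unitaryGroupOfForm hσ J).isClosedEmbedding_subtypeVal.isCompact_preimage hH

/-- **`U(J)(𝒪) = U ∩ GLₙ(𝒪)` is a compact open subgroup of `U = U(σ, J)(E)`** (`σ` continuous). [cite: PlatonovRapinchuk1994, §3.3] -/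
theorem isCompact_isOpen_glInt_subgroupOf_unitaryGroupOfForm (hσ : Continuous σ) :
    IsCompact (((glInt n E).subgroupOf (unitaryGroupOfForm σ J) : Subgroup ↥(unitaryGroupOfForm σ J)) : Set ↥(unitaryGroupOfForm σ J)) ∧
      IsOpen (((glInt n E).subgroupOf (unitaryGroupOfForm σ J) : Subgroup ↥(unitaryGroupOfForm σ J)) : Set ↥(unitaryGroupOfForm σ J)) :=
  ⟨isCompact_subgroupOf_unitaryGroupOfForm σ J hσ (isCompact_glInt n E), isOpen_subgroupOf_unitaryGroupOfForm σ J (isOpen_glInt n E)⟩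

/-- **The congruence subgroups `U ∩ congruenceGL n γ` (`γ ≠ 0`) are compact open in `U`**; in particular the FIRST congruence subgroup
`U(J)(𝒪)₁ = U ∩ (1 + 𝔭Mₙ(𝒪))` at `γ = ϖ = ValuativeRel.uniformizer E` (★ n = 3: `UnitaryGroup.isCompact_isOpen_comap_congruenceGL`).
[cite: PlatonovRapinchuk1994, §3.3] -/
theorem isCompact_isOpen_congruenceGL_subgroupOf_unitaryGroupOfForm (hσ : Continuous σ) {γ : ValueGroupWithZero E} (hγ : γ ≠ 0) :
    IsCompact (((congruenceGL n γ).subgroupOf (unitaryGroupOfForm σ J) : Subgroup ↥(unitaryGroupOfForm σ J)) : Set ↥(unitaryGroupOfForm σ J)) ∧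
      IsOpen (((congruenceGL n γ).subgroupOf (unitaryGroupOfForm σ J) : Subgroup ↥(unitaryGroupOfForm σ J)) : Set ↥(unitaryGroupOfForm σ J)) :=
  ⟨isCompact_subgroupOf_unitaryGroupOfForm σ J hσ (isCompact_congruenceGL γ), isOpen_subgroupOf_unitaryGroupOfForm σ J (isOpen_congruenceGL hγ)⟩

omit [TopologicalSpace E] [IsNonarchimedeanLocalField E] in
/-- Entries of an element of `U(J)(𝒪) = U ∩ GLₙ(𝒪)` are integral (★ `apply_mem_integer_of_mem_glInt`). [cite: PlatonovRapinchuk1994, §3.3] -/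
theorem apply_mem_integer_of_mem_glInt_subgroupOf {g : ↥(unitaryGroupOfForm σ J)}
    (hg : g ∈ (glInt n E).subgroupOf (unitaryGroupOfForm σ J)) (i j : Fin n) :
    ((g : GL (Fin n) E) : Matrix (Fin n) (Fin n) E) i j ∈ 𝒪[E] :=
  apply_mem_integer_of_mem_glInt hg i j

omit [TopologicalSpace E] [IsNonarchimedeanLocalField E] in
/-- Entrywise form of `Matrix.map` along the subring inclusion after a twist: `(M.map τ).map (↑) = (M.map (↑)).map σ` when `↑(τ x) = σ ↑x`. [folklore] -/
private theorem map_map_subtype_eq (τ : 𝒪[E] → 𝒪[E]) (hτ : ∀ x : 𝒪[E], ((τ x : 𝒪[E]) : E) = σ x) (M : Matrix (Fin n) (Fin n) 𝒪[E]) :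
    (M.map τ).map ((↑) : 𝒪[E] → E) = (M.map ((↑) : 𝒪[E] → E)).map σ := by
  ext i j; exact hτ (M i j)

/-- **Reduction modulo `𝔭` on the integral points of the unitary group.**  Let `J = J_𝒪` have integral entries, let `σ` preserve `𝒪` and induce
`σ̄ = σk` on the residue field (`residue (σ x) = σk (residue x)`).  Then reduction of entries is a group homomorphism
`red : U(J)(𝒪) = U(σ, J)(E) ∩ GLₙ(𝒪) → U(σ̄, J̄)(𝓀)`, `J̄ = J_𝒪 mod 𝔭`: `(red g)_{ij} = g_{ij} mod 𝔭` (apply `residue` to `ᵗ(σg) J g = J`, an identity of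
integral matrices; ★ `unitaryGroupOfForm` over the finite field `𝓀` is the finite unitary group counted by «D-T1e»).  Only the entry formula is
exported. [cite: PlatonovRapinchuk1994, §3.3] -/
theorem exists_unitary_residueHom (JO : Matrix (Fin n) (Fin n) 𝒪[E]) (hJ : J = JO.map ((↑) : 𝒪[E] → E))
    (σk : 𝓀[E] →+* 𝓀[E]) (hσO : ∀ x : 𝒪[E], σ x ∈ 𝒪[E])
    (hσk : ∀ x : 𝒪[E], IsLocalRing.residue 𝒪[E] ⟨σ x, hσO x⟩ = σk (IsLocalRing.residue 𝒪[E] x)) :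
    ∃ red : ↥((glInt n E).subgroupOf (unitaryGroupOfForm σ J)) →* ↥(unitaryGroupOfForm σk (JO.map (IsLocalRing.residue 𝒪[E]))),
      ∀ (g : ↥((glInt n E).subgroupOf (unitaryGroupOfForm σ J))) (i j : Fin n),
        (((red g : ↥(unitaryGroupOfForm σk (JO.map (IsLocalRing.residue 𝒪[E])))) : GL (Fin n) 𝓀[E]) : Matrix (Fin n) (Fin n) 𝓀[E]) i j =
          IsLocalRing.residue 𝒪[E] ⟨(((g : ↥(unitaryGroupOfForm σ J)) : GL (Fin n) E) : Matrix (Fin n) (Fin n) E) i j,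
            apply_mem_integer_of_mem_glInt_subgroupOf σ J g.2 i j⟩ := by
  -- the inclusion `U ∩ GLₙ(𝒪) → GLₙ(𝒪)` and ★ `glIntReduction`
  let ρ : ↥(glInt n E) →* GL (Fin n) 𝓀[E] := glIntReduction n E
  have hρ : ∀ (g : ↥(glInt n E)) (i j : Fin n), ((ρ g : GL (Fin n) 𝓀[E]) : Matrix (Fin n) (Fin n) 𝓀[E]) i j =
      IsLocalRing.residue 𝒪[E] ⟨((g : GL (Fin n) E) : Matrix (Fin n) (Fin n) E) i j, apply_mem_integer_of_mem_glInt g.2 i j⟩ :=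
    coe_glIntReduction_apply
  let ι : ↥((glInt n E).subgroupOf (unitaryGroupOfForm σ J)) →* ↥(glInt n E) :=
    ((unitaryGroupOfForm σ J).subtype.comp ((glInt n E).subgroupOf (unitaryGroupOfForm σ J)).subtype).codRestrict (glInt n E)
      fun g => g.2
  -- membership of the reduction in the finite unitary group
  have hmem : ∀ g : ↥((glInt n E).subgroupOf (unitaryGroupOfForm σ J)), ρ (ι g) ∈ unitaryGroupOfForm σk (JO.map (IsLocalRing.residue 𝒪[E])) := by
    intro g
    let τ : 𝒪[E] → 𝒪[E] := fun x => ⟨σ x, hσO x⟩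
    let G : Matrix (Fin n) (Fin n) 𝒪[E] :=
      Matrix.of fun i j => ⟨(((g : ↥(unitaryGroupOfForm σ J)) : GL (Fin n) E) : Matrix (Fin n) (Fin n) E) i j,
        apply_mem_integer_of_mem_glInt_subgroupOf σ J g.2 i j⟩
    have hG : (((g : ↥(unitaryGroupOfForm σ J)) : GL (Fin n) E) : Matrix (Fin n) (Fin n) E) = G.map ((↑) : 𝒪[E] → E) := by
      ext i j; rfl
    have hGρ : ((ρ (ι g) : GL (Fin n) 𝓀[E]) : Matrix (Fin n) (Fin n) 𝓀[E]) = G.map (IsLocalRing.residue 𝒪[E]) := by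
      ext i j; rw [hρ]; rfl
    -- descend the unitarity identity to `𝒪`
    have hU : (((((g : ↥(unitaryGroupOfForm σ J)) : GL (Fin n) E) : Matrix (Fin n) (Fin n) E)).map σ)ᵀ * J *
        (((g : ↥(unitaryGroupOfForm σ J)) : GL (Fin n) E) : Matrix (Fin n) (Fin n) E) = J :=
      mem_unitaryGroupOfForm_iff.1 (g : ↥(unitaryGroupOfForm σ J)).2
    have hinj : Function.Injective (fun M : Matrix (Fin n) (Fin n) 𝒪[E] => M.map ((𝒪[E]).subtype : 𝒪[E] → E)) :=
      Matrix.map_injective Subtype.val_injective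
    have hO : (G.map τ)ᵀ * JO * G = JO := by
      apply hinj
      change ((G.map τ)ᵀ * JO * G).map ⇑(𝒪[E]).subtype = JO.map ⇑(𝒪[E]).subtype
      rw [Matrix.map_mul, Matrix.map_mul, Matrix.transpose_map]
      change ((G.map τ).map ((↑) : 𝒪[E] → E))ᵀ * JO.map ((↑) : 𝒪[E] → E) * G.map ((↑) : 𝒪[E] → E) = JO.map ((↑) : 𝒪[E] → E)
      rw [map_map_subtype_eq σ τ (fun x => rfl), ← hG, ← hJ]
      exact hU
    -- push it to the residue field
    have hk := congrArg (fun M : Matrix (Fin n) (Fin n) 𝒪[E] => M.map (IsLocalRing.residue 𝒪[E])) hO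
    simp only [Matrix.map_mul, Matrix.transpose_map, Matrix.map_map] at hk
    have hcomp : (⇑(IsLocalRing.residue 𝒪[E]) ∘ τ) = (⇑σk ∘ ⇑(IsLocalRing.residue 𝒪[E])) := funext fun x => hσk x
    rw [hcomp, ← Matrix.map_map, ← hGρ] at hk
    exact mem_unitaryGroupOfForm_iff.2 hk
  refine ⟨(ρ.comp ι).codRestrict _ fun g => hmem g, fun g i j => ?_⟩
  change ((ρ (ι g) : GL (Fin n) 𝓀[E]) : Matrix (Fin n) (Fin n) 𝓀[E]) i j = _
  rw [hρ]
  rfl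

/-- **The kernel of the unitary reduction is the first congruence subgroup** `U(J)(𝒪)₁ = U ∩ (1 + 𝔭Mₙ(𝒪))`: for any homomorphism `red` on
`U(J)(𝒪)` with the entry formula (values in any group of invertible matrices over `𝓀`, e.g. `U(σ̄, J̄)(𝓀)`),
`ker red = (U ∩ congruenceGL n ϖ) ∩ U(J)(𝒪)`.  Since that kernel is OPEN, `red` is continuous for the discrete topology on its (finite) target.
[cite: PlatonovRapinchuk1994, §3.3] -/
theorem ker_unitary_residueHom_eq {Q : Subgroup (GL (Fin n) 𝓀[E])}
    (red : ↥((glInt n E).subgroupOf (unitaryGroupOfForm σ J)) →* ↥Q)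
    (hred : ∀ (g : ↥((glInt n E).subgroupOf (unitaryGroupOfForm σ J))) (i j : Fin n),
      (((red g : ↥Q) : GL (Fin n) 𝓀[E]) : Matrix (Fin n) (Fin n) 𝓀[E]) i j =
        IsLocalRing.residue 𝒪[E] ⟨(((g : ↥(unitaryGroupOfForm σ J)) : GL (Fin n) E) : Matrix (Fin n) (Fin n) E) i j,
          apply_mem_integer_of_mem_glInt_subgroupOf σ J g.2 i j⟩) :
    red.ker = ((congruenceGL n (uniformizer E)).subgroupOf (unitaryGroupOfForm σ J)).subgroupOf
      ((glInt n E).subgroupOf (unitaryGroupOfForm σ J)) := by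
  ext g
  rw [MonoidHom.mem_ker, Subgroup.mem_subgroupOf, Subgroup.mem_subgroupOf]
  -- `red g = 1 ↔ ḡ = 1` (same entries)
  have key : red g = 1 ↔ glIntReduction n E ⟨((g : ↥(unitaryGroupOfForm σ J)) : GL (Fin n) E), g.2⟩ = 1 := by
    constructor
    · intro h
      apply Units.ext; ext i j
      have := congrArg (fun w : ↥Q => ((w : GL (Fin n) 𝓀[E]) : Matrix (Fin n) (Fin n) 𝓀[E]) i j) h
      simp only [hred, OneMemClass.coe_one, Units.val_one] at this
      rw [coe_glIntReduction_apply, Units.val_one, ← this]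
    · intro h
      apply Subtype.ext; apply Units.ext; ext i j
      have := congrArg (fun w : GL (Fin n) 𝓀[E] => (w : Matrix (Fin n) (Fin n) 𝓀[E]) i j) h
      simp only [coe_glIntReduction_apply, Units.val_one] at this
      rw [OneMemClass.coe_one, Units.val_one, hred, ← this]
  rw [key, ← MonoidHom.mem_ker, ker_glIntReduction_eq_congruenceGL_subgroupOf, Subgroup.mem_subgroupOf]

/-- **The level-structure volume identity** `vol U(J)(𝒪) = |red(U(J)(𝒪))| · vol U(J)(𝒪)₁` for every left-invariant Borel measure `μ` on
`U = U(σ, J)(E)` and every reduction homomorphism `red` with the entry formula into a group of invertible matrices over the (finite) residue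
field (no continuity of `σ` needed: both levels are open, the index is finite because `GLₙ(𝓀)` is). [cite: PlatonovRapinchuk1994, §3.3] -/
theorem measure_glInt_subgroupOf_eq_natCard_range_mul
    [MeasurableSpace ↥(unitaryGroupOfForm σ J)] [BorelSpace ↥(unitaryGroupOfForm σ J)]
    (μ : Measure ↥(unitaryGroupOfForm σ J)) [μ.IsMulLeftInvariant] {Q : Subgroup (GL (Fin n) 𝓀[E])}
    (red : ↥((glInt n E).subgroupOf (unitaryGroupOfForm σ J)) →* ↥Q)
    (hred : ∀ (g : ↥((glInt n E).subgroupOf (unitaryGroupOfForm σ J))) (i j : Fin n),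
      (((red g : ↥Q) : GL (Fin n) 𝓀[E]) : Matrix (Fin n) (Fin n) 𝓀[E]) i j =
        IsLocalRing.residue 𝒪[E] ⟨(((g : ↥(unitaryGroupOfForm σ J)) : GL (Fin n) E) : Matrix (Fin n) (Fin n) E) i j,
          apply_mem_integer_of_mem_glInt_subgroupOf σ J g.2 i j⟩) :
    μ ((glInt n E).subgroupOf (unitaryGroupOfForm σ J)) =
      Nat.card red.range * μ ((congruenceGL n (uniformizer E)).subgroupOf (unitaryGroupOfForm σ J)) := by
  haveI : Finite ↥Q := inferInstance
  exact measure_subgroup_eq_natCard_range_mul μ (Subgroup.subgroupOf_mono _ (congruenceGL_le_glInt _))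
    (isOpen_subgroupOf_unitaryGroupOfForm σ J (isOpen_glInt n E)).measurableSet
    (isOpen_subgroupOf_unitaryGroupOfForm σ J (isOpen_congruenceGL uniformizer_ne_zero)).measurableSet red
    (ker_unitary_residueHom_eq σ J red hred)

/-- **Under surjectivity of the reduction** (the Hensel ∕ smoothness letter `hsurj`, NOT proved here): `vol U(J)(𝒪) = |U(σ̄, J̄)(𝓀)| · vol U(J)(𝒪)₁`
— at an inert place (`𝓀 = 𝔽_{q²}`, `σ̄ = x ↦ x^q`) the right-hand count is the order of the finite unitary group `|Uₙ(𝔽_{q²}∕𝔽_q)|`.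
[cite: PlatonovRapinchuk1994, §3.3] -/
theorem measure_glInt_subgroupOf_eq_natCard_mul_of_surjective
    [MeasurableSpace ↥(unitaryGroupOfForm σ J)] [BorelSpace ↥(unitaryGroupOfForm σ J)]
    (μ : Measure ↥(unitaryGroupOfForm σ J)) [μ.IsMulLeftInvariant] {Q : Subgroup (GL (Fin n) 𝓀[E])}
    (red : ↥((glInt n E).subgroupOf (unitaryGroupOfForm σ J)) →* ↥Q)
    (hred : ∀ (g : ↥((glInt n E).subgroupOf (unitaryGroupOfForm σ J))) (i j : Fin n),
      (((red g : ↥Q) : GL (Fin n) 𝓀[E]) : Matrix (Fin n) (Fin n) 𝓀[E]) i j =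
        IsLocalRing.residue 𝒪[E] ⟨(((g : ↥(unitaryGroupOfForm σ J)) : GL (Fin n) E) : Matrix (Fin n) (Fin n) E) i j,
          apply_mem_integer_of_mem_glInt_subgroupOf σ J g.2 i j⟩)
    (hsurj : Function.Surjective red) :
    μ ((glInt n E).subgroupOf (unitaryGroupOfForm σ J)) =
      Nat.card ↥Q * μ ((congruenceGL n (uniformizer E)).subgroupOf (unitaryGroupOfForm σ J)) := by
  haveI : Finite ↥Q := inferInstance
  exact measure_subgroup_eq_natCard_mul_of_surjective μ (Subgroup.subgroupOf_mono _ (congruenceGL_le_glInt _))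
    (isOpen_subgroupOf_unitaryGroupOfForm σ J (isOpen_glInt n E)).measurableSet
    (isOpen_subgroupOf_unitaryGroupOfForm σ J (isOpen_congruenceGL uniformizer_ne_zero)).measurableSet red
    (ker_unitary_residueHom_eq σ J red hred) hsurj

/-- **The reduction-free form**: `[U(J)(𝒪) : U(J)(𝒪)₁]` is FINITE (non-zero) and `vol U(J)(𝒪) = [U(J)(𝒪) : U(J)(𝒪)₁] · vol U(J)(𝒪)₁`, whenever `J`
has integral entries and `σ` preserves `𝒪` inducing some `σ̄` on `𝓀` (e.g. any continuous involution of `E`: inert ⇒ Frobenius, ramified ⇒ `id`).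
[cite: PlatonovRapinchuk1994, §3.3] -/
theorem measure_glInt_subgroupOf_eq_relIndex_mul
    [MeasurableSpace ↥(unitaryGroupOfForm σ J)] [BorelSpace ↥(unitaryGroupOfForm σ J)]
    (μ : Measure ↥(unitaryGroupOfForm σ J)) [μ.IsMulLeftInvariant]
    (JO : Matrix (Fin n) (Fin n) 𝒪[E]) (hJ : J = JO.map ((↑) : 𝒪[E] → E))
    (σk : 𝓀[E] →+* 𝓀[E]) (hσO : ∀ x : 𝒪[E], σ x ∈ 𝒪[E])
    (hσk : ∀ x : 𝒪[E], IsLocalRing.residue 𝒪[E] ⟨σ x, hσO x⟩ = σk (IsLocalRing.residue 𝒪[E] x)) :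
    ((congruenceGL n (uniformizer E)).subgroupOf (unitaryGroupOfForm σ J)).relIndex
        ((glInt n E).subgroupOf (unitaryGroupOfForm σ J)) ≠ 0 ∧
      μ ((glInt n E).subgroupOf (unitaryGroupOfForm σ J)) =
        ((congruenceGL n (uniformizer E)).subgroupOf (unitaryGroupOfForm σ J)).relIndex
            ((glInt n E).subgroupOf (unitaryGroupOfForm σ J)) *
          μ ((congruenceGL n (uniformizer E)).subgroupOf (unitaryGroupOfForm σ J)) := by
  obtain ⟨red, hred⟩ := exists_unitary_residueHom σ J JO hJ σk hσO hσk
  haveI : Finite ↥(unitaryGroupOfForm σk (JO.map (IsLocalRing.residue 𝒪[E]))) := inferInstance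
  have hfin := relIndex_ne_zero_of_ker_eq red (ker_unitary_residueHom_eq σ J red hred)
  exact ⟨hfin, measure_subgroup_eq_relIndex_mul μ (Subgroup.subgroupOf_mono _ (congruenceGL_le_glInt _))
    (isOpen_subgroupOf_unitaryGroupOfForm σ J (isOpen_glInt n E)).measurableSet
    (isOpen_subgroupOf_unitaryGroupOfForm σ J (isOpen_congruenceGL uniformizer_ne_zero)).measurableSet hfin⟩

end Unitary

end Literature.NumberTheory.Automorphic
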